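import Summits.CriticalPhenomena.SAWScalingLimit.Theorems.SAWDefectDecoherenceObservableToSLEROrientationCoOrientedLattice
import Summits.CriticalPhenomena.SAWScalingLimit.Theorems.SAWDefectDecoherenceObservableToSLERGateDefs
import Summits.CriticalPhenomena.SAWScalingLimit.Theorems.SAWDefectDecoherenceObservableToSLERNestedGateDefs
import Summits.CriticalPhenomena.SAWScalingLimit.Theorems.SAWDefectDecoherenceObservableToSLERNestedLinkDefs
import Summits.CriticalPhenomena.SAWScalingLimit.Theorems.SAWDevelopingMapHexTransferQuarterTurnCovariance
import Literature.Probability.RandomPlanarGeometry.SimpleCurves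
import Literature.Probability.RandomPlanarGeometry.ChordalCurveFamily
import Literature.Probability.RandomPlanarGeometry.SLE
import HarnessLib

/-!
# Stub H1 `stub_rotationSAW` of line `six-class-type-ladder` (crux
`SAWDevelopingMap.ObservableToSLE`, stmt-CriticalPhenomena-10472): lattice-rotation transport of
the critical hexagonal SAW model

The line reduces carved-law identification for a CO-ORIENTED flat class `(j, j)` to the class
`(0, 0)` by rotating everything by `conj(ζ^j)` (`ζ = triZeta = e^{iπ/3}`); this is the LATTICE half.
Generic layer (any embedded graph, theorems only): a bijection of vertices compatible with the
mesh vertices and the mesh graphs of two domains transports the whole discretisation `Ω ↦ Ω_δ`,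
including the union-of-largest-components convention (`mem_embMeshDomain_transport`, via
`SimpleGraph.Iso.connectedComponentEquiv` / `ConnectedComponent.isoEquivSupp`), hence the graph
`Ω_δ` (`embDomainGraph_adj_transport`); an isomorphism `Φ` of discrete domains induces a bijection
of self-avoiding walks mapping supports by `Φ` (`exists_sawEquiv`, `Walk.map`); and ANY bijection
`E` mapping supports by an injective vertex map `T` preserves vertex counts, pushes `embWeight` /
`embLaw` and their restrictions to the walks avoiding a vertex set forward (`Measure.map_sum`,
`Measure.sum_comp_equiv`, `Measure.restrict_map`), and maps curves by any plane map affine on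
segments realising `T` on mesh points (`apply_polylineFrom_of_lineMap` of the `δℤ²` template
`…HexTransferQuarterTurnCovariance`).  Hexagonal layer: `T = σ^{-n} = (hexRotIso n).symm` acts on
face centres by `z ↦ conj(ζ^n) z` (`hexCenter_hexRotIso_symm`), which commutes with `δ •` and maps
segments to segments and closures to closures, so `T` is an automorphism of the discretisation
(`hexDomainGraph_adj_rot`) and the registered statement follows (`exists_hexSAWRotEquiv`).
References: H. Duminil-Copin, S. Smirnov, Ann. of Math. 175 (2012) (arXiv:1007.0575) §4;
G. F. Lawler, O. Schramm, W. Werner, *On the scaling limit of planar self-avoiding walk* (2004)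
§3.4.  Templates: `LatticeModels/CellGridSaddleSymmetry.lean`, `…/TriangularLatticeReflection.lean`.
-/

noncomputable section

open scoped BigOperators Topology NNReal ENNReal Classical BoundedContinuousFunction
open scoped ComplexConjugate
open Filter Set MeasureTheory Metric
open Literature.Probability.LatticeModels (HexVertex hexGraph hexCenter triZeta Site polyline)
open Literature.Probability.RandomPlanarGeometry
open Literature.Probability.RandomPlanarGeometry.SAW

namespace Summit.CriticalPhenomena.SAWScalingLimit.Theorems.ObservableToSLE.TypeLadder

open Summit.CriticalPhenomena.SAWScalingLimit.Theorems.ObservableToSLER.BridgeGate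
open Summit.CriticalPhenomena.SAWScalingLimit.Theorems.ObservableToSLER.NestedGate

/-! ### Transport of the discretisation and of self-avoiding walks (generic embedded graph) -/

section Transport

variable {V V' : Type*} {G : SimpleGraph V} {G' : SimpleGraph V'} {emb : V → ℂ} {emb' : V' → ℂ}
  {Ω Ω' : Set ℂ} {δ δ' : ℝ} {a b : V} {a' b' : V'}

/-- **The discrete domain is transported** along a bijection of vertices compatible with the mesh
vertices and the mesh graphs (largest components correspond under the induced isomorphism of mesh
vertex graphs, supports and their sizes being preserved). [folklore] -/
theorem mem_embMeshDomain_transport (T : V ≃ V')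
    (hV : ∀ v, T v ∈ embMeshVertices emb' Ω' δ' ↔ v ∈ embMeshVertices emb Ω δ)
    (hA : ∀ x y, (embMeshGraph G' emb' Ω' δ').Adj (T x) (T y) ↔ (embMeshGraph G emb Ω δ).Adj x y)
    (x : V) : T x ∈ embMeshDomain G' emb' Ω' δ' ↔ x ∈ embMeshDomain G emb Ω δ := by
  obtain ⟨φ, hφ⟩ : ∃ φ : embMeshVertexGraph G emb Ω δ ≃g embMeshVertexGraph G' emb' Ω' δ',
      ∀ v, ((φ v : embMeshVertices emb' Ω' δ') : V') = T v :=
    ⟨{ toEquiv := T.subtypeEquiv fun v => (hV v).symm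
       map_rel_iff' := by
         rintro ⟨x, hx⟩ ⟨y, hy⟩
         simp only [SimpleGraph.comap_adj, Function.Embedding.coe_subtype,
           Equiv.subtypeEquiv_apply]
         exact hA x y }, fun _ => rfl⟩
  have hsupp : ∀ (C : (embMeshVertexGraph G emb Ω δ).ConnectedComponent)
      (y : embMeshVertices emb' Ω' δ'),
      y ∈ (φ.connectedComponentEquiv C).supp ↔ φ.symm y ∈ C.supp := by
    intro C y
    rw [SimpleGraph.ConnectedComponent.mem_supp_iff, SimpleGraph.ConnectedComponent.mem_supp_iff,
      SimpleGraph.Iso.connectedComponentEquiv_apply,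
      ← SimpleGraph.ConnectedComponent.iso_inv_image_comp_eq_iff_eq_map]
  have hcard : ∀ C : (embMeshVertexGraph G emb Ω δ).ConnectedComponent,
      (φ.connectedComponentEquiv C).supp.ncard = C.supp.ncard := by
    intro C
    rw [Set.ncard_def, Set.ncard_def]
    exact (Nat.card_congr (SimpleGraph.ConnectedComponent.isoEquivSupp φ C)).symm
  constructor
  · intro hx
    simp only [embMeshDomain, mem_iUnion, mem_image] at hx
    obtain ⟨C', hmax, y, hy, hyx⟩ := hx
    simp only [embMeshDomain, mem_iUnion, mem_image]
    have hxV : x ∈ embMeshVertices emb Ω δ := by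
      rw [← hV, ← hyx]; exact y.2
    have hy' : y = φ ⟨x, hxV⟩ := Subtype.ext (hyx.trans (hφ ⟨x, hxV⟩).symm)
    refine ⟨φ.connectedComponentEquiv.symm C', fun C => ?_, ⟨x, hxV⟩, ?_, rfl⟩
    · have h1 : (φ.connectedComponentEquiv.symm C').supp.ncard = C'.supp.ncard := by
        rw [← hcard, Equiv.apply_symm_apply]
      rw [h1, ← hcard]
      exact hmax _
    · have h2 := hsupp (φ.connectedComponentEquiv.symm C') y
      rw [Equiv.apply_symm_apply] at h2
      have h3 : φ.symm y = ⟨x, hxV⟩ := by rw [hy', φ.symm_apply_apply]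
      rw [← h3]
      exact h2.1 hy
  · intro hx
    simp only [embMeshDomain, mem_iUnion, mem_image] at hx
    obtain ⟨C, hmax, y, hy, rfl⟩ := hx
    simp only [embMeshDomain, mem_iUnion, mem_image]
    refine ⟨φ.connectedComponentEquiv C, fun C'' => ?_, φ y, ?_, hφ y⟩
    · have h1 : C'' = φ.connectedComponentEquiv (φ.connectedComponentEquiv.symm C'') :=
        (Equiv.apply_symm_apply _ _).symm
      rw [h1, hcard, hcard]
      exact hmax _
    · rw [hsupp, φ.symm_apply_apply]
      exact hy

/-- The graph `Ω_δ` is transported along such a bijection. [folklore] -/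
theorem embDomainGraph_adj_transport (T : V ≃ V')
    (hV : ∀ v, T v ∈ embMeshVertices emb' Ω' δ' ↔ v ∈ embMeshVertices emb Ω δ)
    (hA : ∀ x y, (embMeshGraph G' emb' Ω' δ').Adj (T x) (T y) ↔ (embMeshGraph G emb Ω δ).Adj x y)
    (x y : V) :
    (embDomainGraph G' emb' Ω' δ').Adj (T x) (T y) ↔ (embDomainGraph G emb Ω δ).Adj x y := by
  rw [embDomainGraph_adj_iff, embDomainGraph_adj_iff, hA, mem_embMeshDomain_transport T hV hA,
    mem_embMeshDomain_transport T hV hA]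

/-- A self-avoiding walk of `Ω_δ` is determined by its underlying walk. [folklore] -/
theorem embDomainSAW_walk_injective :
    Function.Injective (EmbDomainSAW.walk : EmbDomainSAW G emb Ω δ a b → _) := by
  rintro ⟨p, hp⟩ ⟨q, hq⟩ (rfl : p = q)
  rfl

/-- **An isomorphism of discrete domains induces a bijection of self-avoiding walks**
`γ ↦ Φ ∘ γ` (`Walk.map`; injective since `Φ` is, surjective via `Φ⁻¹`), mapping supports by `Φ`.
[folklore] -/
theorem exists_sawEquiv (Φ : embDomainGraph G emb Ω δ ≃g embDomainGraph G' emb' Ω' δ')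
    (ha : Φ a = a') (hb : Φ b = b') :
    ∃ E : EmbDomainSAW G emb Ω δ a b ≃ EmbDomainSAW G' emb' Ω' δ' a' b',
      ∀ γ, (E γ).walk.support = γ.walk.support.map Φ := by
  subst ha hb
  have hinj : Function.Injective Φ.toHom := fun x y h => Φ.injective h
  set F : EmbDomainSAW G emb Ω δ a b → EmbDomainSAW G' emb' Ω' δ' (Φ a) (Φ b) :=
    fun γ => ⟨γ.walk.map Φ.toHom, γ.isPath.map hinj⟩ with hF
  have hbij : Function.Bijective F := by
    refine ⟨fun γ₁ γ₂ h => embDomainSAW_walk_injective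
      (SimpleGraph.Walk.map_injective_of_injective hinj a b (congrArg EmbDomainSAW.walk h)), ?_⟩
    rintro ⟨q, hq⟩
    refine ⟨⟨(q.map Φ.symm.toHom).copy (Φ.symm_apply_apply a) (Φ.symm_apply_apply b), ?_⟩, ?_⟩
    · rw [SimpleGraph.Walk.isPath_copy]
      exact hq.map fun x y h => Φ.symm.injective h
    · apply embDomainSAW_walk_injective
      apply SimpleGraph.Walk.support_injective
      change (((q.map Φ.symm.toHom).copy _ _).map Φ.toHom).support = q.support
      rw [SimpleGraph.Walk.support_map, SimpleGraph.Walk.support_copy,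
        SimpleGraph.Walk.support_map, List.map_map]
      conv_rhs => rw [← List.map_id q.support]
      exact List.map_congr_left fun x _ => Φ.apply_symm_apply x
  refine ⟨Equiv.ofBijective F hbij, fun γ => ?_⟩
  change (γ.walk.map Φ.toHom).support = _
  rw [SimpleGraph.Walk.support_map]
  rfl

variable {T : V → V'}

/-- If supports correspond under a vertex map, the numbers of visited vertices agree. [folklore] -/
theorem vertexCount_eq_of_support
    {E : EmbDomainSAW G emb Ω δ a b → EmbDomainSAW G' emb' Ω' δ' a' b'}
    (hE : ∀ γ, (E γ).walk.support = γ.walk.support.map T) (γ : EmbDomainSAW G emb Ω δ a b) :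
    (E γ).vertexCount = γ.vertexCount := by
  have h := congrArg List.length (hE γ)
  rw [List.length_map, SimpleGraph.Walk.length_support, SimpleGraph.Walk.length_support] at h
  exact h

/-- **The SAW weight at any fugacity is pushed forward to the SAW weight** along a bijection of
self-avoiding walks under which supports correspond. [folklore] -/
theorem map_embWeight_of_support (E : EmbDomainSAW G emb Ω δ a b ≃ EmbDomainSAW G' emb' Ω' δ' a' b')
    (hE : ∀ γ, (E γ).walk.support = γ.walk.support.map T) (x : ℝ) :
    (embWeight G emb Ω δ x a b).map E = embWeight G' emb' Ω' δ' x a' b' := by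
  have hm : Measurable E := EmbDomainSAW.measurable_of_top _
  rw [embWeight, Measure.map_sum hm.aemeasurable]
  simp only [Measure.map_smul, Measure.map_dirac' hm]
  rw [embWeight, ← Measure.sum_comp_equiv E]
  exact congrArg Measure.sum (funext fun γ => by
    rw [Function.comp_apply, vertexCount_eq_of_support hE])

/-- Normalisation commutes with push-forward along a measurable map. [folklore] -/
theorem map_normalise {α β : Type*} [MeasurableSpace α] [MeasurableSpace β] (μ : Measure α)
    {f : α → β} (hf : Measurable f) :
    ((μ Set.univ)⁻¹ • μ).map f = (μ.map f Set.univ)⁻¹ • μ.map f := by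
  rw [Measure.map_smul, Measure.map_apply hf MeasurableSet.univ, Set.preimage_univ]

/-- **The SAW law `P_{x,δ}` is pushed forward to the SAW law.** [folklore] -/
theorem map_embLaw_of_support (E : EmbDomainSAW G emb Ω δ a b ≃ EmbDomainSAW G' emb' Ω' δ' a' b')
    (hE : ∀ γ, (E γ).walk.support = γ.walk.support.map T) (x : ℝ) :
    (embLaw G emb Ω δ x a b).map E = embLaw G' emb' Ω' δ' x a' b' := by
  rw [embLaw, map_normalise _ (EmbDomainSAW.measurable_of_top _), map_embWeight_of_support E hE,
    embLaw]

/-- **The weight restricted to the walks avoiding `S` is pushed forward to the weight restricted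
to the walks avoiding `T '' S`** (`T` injective). [folklore] -/
theorem map_restrict_embWeight_of_support (hT : Function.Injective T)
    (E : EmbDomainSAW G emb Ω δ a b ≃ EmbDomainSAW G' emb' Ω' δ' a' b')
    (hE : ∀ γ, (E γ).walk.support = γ.walk.support.map T) (x : ℝ) (S : Set V) :
    ((embWeight G emb Ω δ x a b).restrict {γ | ∀ v ∈ γ.walk.support, v ∉ S}).map E =
      (embWeight G' emb' Ω' δ' x a' b').restrict {γ | ∀ v ∈ γ.walk.support, v ∉ T '' S} := by
  have hm : Measurable E := EmbDomainSAW.measurable_of_top _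
  rw [← map_embWeight_of_support E hE, Measure.restrict_map hm MeasurableSpace.measurableSet_top]
  congr 2
  ext γ
  simp only [Set.mem_preimage, Set.mem_setOf_eq, hE, List.forall_mem_map, hT.mem_set_image]

/-- **The curve of a walk whose support is the `T`-image is the image curve**, for a plane map
`f` affine on segments realising `T` on mesh points (`f (δ emb v) = δ' emb' (T v)`): both
polylines carry the same dyadic parametrisation. [folklore] -/
theorem curve_eq_of_support {E : EmbDomainSAW G emb Ω δ a b → EmbDomainSAW G' emb' Ω' δ' a' b'}
    (hE : ∀ γ, (E γ).walk.support = γ.walk.support.map T) (f : C(ℂ, ℂ))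
    (hf : ∀ (x y : ℂ) (c : ℝ), f (AffineMap.lineMap x y c) = AffineMap.lineMap (f x) (f y) c)
    (hT : ∀ v, f ((δ : ℂ) * emb v) = (δ' : ℂ) * emb' (T v)) (γ : EmbDomainSAW G emb Ω δ a b) :
    (E γ).curve = CurveClass.map f γ.curve := by
  rw [EmbDomainSAW.curve, EmbDomainSAW.curve, CurveClass.map_mk]
  congr 1
  ext t
  change (E γ).walk.toCurve (fun v => (δ' : ℂ) * emb' v) t =
    f (γ.walk.toCurve (fun v => (δ : ℂ) * emb v) t)
  rw [SimpleGraph.Walk.toCurve, SimpleGraph.Walk.toCurve, hE γ, ← γ.walk.cons_tail_support]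
  have hl : (γ.walk.support.tail.map T).map (fun v => (δ' : ℂ) * emb' v) =
      (γ.walk.support.tail.map fun v => (δ : ℂ) * emb v).map f := by
    rw [List.map_map, List.map_map]
    exact List.map_congr_left fun v _ => (hT v).symm
  simp only [List.map_cons, hl, ← hT, polyline, Path.coe_toContinuousMap]
  exact (Cruxes.HexTransfer.PinTheShear.apply_polylineFrom_of_lineMap f hf _ _ t).symm

end Transport

/-! ### The lattice rotation `σ^{-n}` over the plane rotation `z ↦ conj(ζ^n) z` -/

section Rotation

variable (n : ℕ) (Ω : Set ℂ) (δ : ℝ)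

/-- The plane rotation is affine on segments. [folklore] -/
theorem rot_lineMap (x y : ℂ) (t : ℝ) :
    conj (triZeta ^ n) * AffineMap.lineMap x y t =
      AffineMap.lineMap (conj (triZeta ^ n) * x) (conj (triZeta ^ n) * y) t := by
  simp only [AffineMap.lineMap_apply_module, mul_add, mul_smul_comm]

/-- **Mesh points are rotated:** `δ c(σ^{-n} v) = conj(ζ^n) · (δ c(v))`. [folklore] -/
theorem rot_meshPoint (v : HexVertex) :
    (δ : ℂ) * hexCenter ((hexRotIso n).symm v) = conj (triZeta ^ n) * ((δ : ℂ) * hexCenter v) := by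
  rw [hexCenter_hexRotIso_symm, mul_left_comm]

/-- Mesh vertices are rotated. [folklore] -/
theorem mem_embMeshVertices_rot (v : HexVertex) :
    (hexRotIso n).symm v ∈
        embMeshVertices hexCenter ((fun z : ℂ => conj (triZeta ^ n) * z) '' Ω) δ ↔
      v ∈ embMeshVertices hexCenter Ω δ := by
  rw [mem_embMeshVertices_iff, mem_embMeshVertices_iff, rot_meshPoint,
    (mul_right_injective₀ (left_ne_zero_of_mul_eq_one (conj_triZeta_pow_mul_self n))).mem_set_image]

/-- The closed-segment edge rule is rotated (the rotation is linear and a homeomorphism).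
[folklore] -/
theorem segment_rot_subset_closure_iff (p q : ℂ) :
    segment ℝ (conj (triZeta ^ n) * p) (conj (triZeta ^ n) * q) ⊆
        closure ((fun z : ℂ => conj (triZeta ^ n) * z) '' Ω) ↔
      segment ℝ p q ⊆ closure Ω := by
  have hc : conj (triZeta ^ n) ≠ 0 := left_ne_zero_of_mul_eq_one (conj_triZeta_pow_mul_self n)
  have hseg : segment ℝ (conj (triZeta ^ n) * p) (conj (triZeta ^ n) * q) =
      (fun z : ℂ => conj (triZeta ^ n) * z) '' segment ℝ p q :=
    (image_segment ℝ (LinearMap.mulLeft ℝ (conj (triZeta ^ n))).toAffineMap p q).symm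
  have hcl : closure ((fun z : ℂ => conj (triZeta ^ n) * z) '' Ω) =
      (fun z : ℂ => conj (triZeta ^ n) * z) '' closure Ω :=
    ((Homeomorph.mulLeft₀ _ hc).image_closure Ω).symm
  rw [hseg, hcl, Set.image_subset_image_iff (mul_right_injective₀ hc)]

/-- The mesh graph is rotated. [folklore] -/
theorem embMeshGraph_adj_rot (x y : HexVertex) :
    (embMeshGraph hexGraph hexCenter ((fun z : ℂ => conj (triZeta ^ n) * z) '' Ω) δ).Adj
        ((hexRotIso n).symm x) ((hexRotIso n).symm y) ↔
      (embMeshGraph hexGraph hexCenter Ω δ).Adj x y := by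
  rw [embMeshGraph_adj_iff, embMeshGraph_adj_iff, rot_meshPoint, rot_meshPoint,
    segment_rot_subset_closure_iff, SimpleGraph.Iso.map_adj_iff]

/-- **The discrete domain is rotated:** `σ^{-n} v ∈ (conj(ζ^n) Ω)_δ ↔ v ∈ Ω_δ` (mesh vertices,
the closed-segment edge rule and the union-of-largest-components convention are all transported).
[folklore] -/
theorem mem_embMeshDomain_rot (v : HexVertex) :
    (hexRotIso n).symm v ∈
        embMeshDomain hexGraph hexCenter ((fun z : ℂ => conj (triZeta ^ n) * z) '' Ω) δ ↔
      v ∈ embMeshDomain hexGraph hexCenter Ω δ :=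
  mem_embMeshDomain_transport (hexRotIso n).symm.toEquiv (mem_embMeshVertices_rot n Ω δ)
    (embMeshGraph_adj_rot n Ω δ) v

/-- **The lattice rotation is an automorphism of the discretisation:**
`σ^{-n} x ∼ σ^{-n} y` in `(conj(ζ^n) Ω)_δ` iff `x ∼ y` in `Ω_δ`. [folklore] -/
theorem hexDomainGraph_adj_rot (x y : HexVertex) :
    (hexDomainGraph ((fun z : ℂ => conj (triZeta ^ n) * z) '' Ω) δ).Adj ((hexRotIso n).symm x)
        ((hexRotIso n).symm y) ↔ (hexDomainGraph Ω δ).Adj x y :=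
  embDomainGraph_adj_transport (hexRotIso n).symm.toEquiv (mem_embMeshVertices_rot n Ω δ)
    (embMeshGraph_adj_rot n Ω δ) x y

variable (x y : HexVertex)

/-- **The induced bijection of self-avoiding walks**
`Ω_δ(x → y) ≃ (conj(ζ^n) Ω)_δ(σ^{-n} x → σ^{-n} y)`, mapping supports by `σ^{-n}`. [folklore] -/
theorem exists_hexSAWRotEquiv :
    ∃ E : HexDomainSAW Ω δ x y ≃ HexDomainSAW ((fun z : ℂ => conj (triZeta ^ n) * z) '' Ω) δ
      ((hexRotIso n).symm x) ((hexRotIso n).symm y),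
      ∀ γ, (E γ).walk.support = γ.walk.support.map ⇑(hexRotIso n).symm :=
  exists_sawEquiv ⟨(hexRotIso n).symm.toEquiv, fun {u v} => hexDomainGraph_adj_rot n Ω δ u v⟩
    rfl rfl

variable {n Ω δ x y}
  {E : HexDomainSAW Ω δ x y ≃ HexDomainSAW ((fun z : ℂ => conj (triZeta ^ n) * z) '' Ω) δ
    ((hexRotIso n).symm x) ((hexRotIso n).symm y)}
  (hE : ∀ γ, (E γ).walk.support = γ.walk.support.map ⇑(hexRotIso n).symm)
include hE

/-- Curves are rotated. [folklore] -/
theorem curve_rot (γ : HexDomainSAW Ω δ x y) :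
    (E γ).curve =
      CurveClass.map ⟨fun z : ℂ => conj (triZeta ^ n) * z, continuous_const_mul _⟩ γ.curve :=
  curve_eq_of_support hE _ (rot_lineMap n) (fun v => (rot_meshPoint n δ v).symm) γ

/-- The critical weight is pushed forward to the critical weight. [folklore] -/
theorem map_hexSAWWeight_rot :
    (hexSAWWeight Ω δ x y).map E =
      hexSAWWeight ((fun z : ℂ => conj (triZeta ^ n) * z) '' Ω) δ
        ((hexRotIso n).symm x) ((hexRotIso n).symm y) :=
  map_embWeight_of_support E hE _

/-- The critical law is pushed forward to the critical law. [folklore] -/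
theorem map_hexSAWLaw_rot :
    (hexSAWLaw Ω δ x y).map E =
      hexSAWLaw ((fun z : ℂ => conj (triZeta ^ n) * z) '' Ω) δ
        ((hexRotIso n).symm x) ((hexRotIso n).symm y) :=
  map_embLaw_of_support E hE _

/-- The carved weight (walks avoiding `S`) is pushed forward to the carved weight (walks avoiding
`σ^{-n} S`). [folklore] -/
theorem map_carvedWeight_rot (S : Set HexVertex) :
    (carvedWeight Ω δ S x y).map E =
      carvedWeight ((fun z : ℂ => conj (triZeta ^ n) * z) '' Ω) δ (⇑(hexRotIso n).symm '' S)
        ((hexRotIso n).symm x) ((hexRotIso n).symm y) :=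
  map_restrict_embWeight_of_support (hexRotIso n).symm.injective E hE _ S

/-- The carved law is pushed forward to the carved law. [folklore] -/
theorem map_carvedLaw_rot (S : Set HexVertex) :
    (carvedLaw Ω δ S x y).map E =
      carvedLaw ((fun z : ℂ => conj (triZeta ^ n) * z) '' Ω) δ (⇑(hexRotIso n).symm '' S)
        ((hexRotIso n).symm x) ((hexRotIso n).symm y) := by
  rw [carvedLaw, map_normalise _ (EmbDomainSAW.measurable_of_top _), map_carvedWeight_rot hE,
    carvedLaw]

end Rotation

/-! ### The registered stub -/

/-- **H1 `stub_rotationSAW` — lattice-rotation transport of the critical hexagonal SAW model.**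
For every `n`, domain `Ω`, mesh `δ` and endpoints `x, y`, the lattice rotation `T = σ^{-n}`
(`(hexRotIso n).symm`, acting on face centres by `z ↦ conj(ζ^n) z`) induces a bijection `E` of
the self-avoiding walks of `Ω_δ` from `x` to `y` onto those of `(conj(ζ^n) Ω)_δ` from `T x` to
`T y` (the discretisation — mesh vertices, closed-segment edge rule, union of the largest
components — is canonical, hence rotated), mapping supports by `T`, curves by the plane
rotation, and pushing the critical weight / law and every carved weight / law (walks avoiding
`S`, resp. `T S`) forward to their rotated counterparts. [folklore] -/
theorem stub_rotationSAW :
    ∀ (n : ℕ) (Ω : Set ℂ) (δ : ℝ) (x y : HexVertex),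
      ∃ E : HexDomainSAW Ω δ x y ≃
          HexDomainSAW ((fun z : ℂ => (starRingEnd ℂ) (triZeta ^ n) * z) '' Ω) δ
            ((hexRotIso n).symm x) ((hexRotIso n).symm y),
        (∀ γ, (E γ).walk.support = γ.walk.support.map ⇑(hexRotIso n).symm) ∧
        (∀ γ, (E γ).curve =
          CurveClass.map ⟨fun z : ℂ => (starRingEnd ℂ) (triZeta ^ n) * z, continuous_const_mul _⟩
            γ.curve) ∧
        (hexSAWWeight Ω δ x y).map E =
          hexSAWWeight ((fun z : ℂ => (starRingEnd ℂ) (triZeta ^ n) * z) '' Ω) δ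
            ((hexRotIso n).symm x) ((hexRotIso n).symm y) ∧
        (hexSAWLaw Ω δ x y).map E =
          hexSAWLaw ((fun z : ℂ => (starRingEnd ℂ) (triZeta ^ n) * z) '' Ω) δ
            ((hexRotIso n).symm x) ((hexRotIso n).symm y) ∧
        (∀ S : Set HexVertex, (carvedWeight Ω δ S x y).map E =
          carvedWeight ((fun z : ℂ => (starRingEnd ℂ) (triZeta ^ n) * z) '' Ω) δ
            (⇑(hexRotIso n).symm '' S) ((hexRotIso n).symm x) ((hexRotIso n).symm y)) ∧
        (∀ S : Set HexVertex, (carvedLaw Ω δ S x y).map E =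
          carvedLaw ((fun z : ℂ => (starRingEnd ℂ) (triZeta ^ n) * z) '' Ω) δ
            (⇑(hexRotIso n).symm '' S) ((hexRotIso n).symm x) ((hexRotIso n).symm y)) := by
  intro n Ω δ x y
  obtain ⟨E, hE⟩ := exists_hexSAWRotEquiv n Ω δ x y
  exact ⟨E, hE, curve_rot hE, map_hexSAWWeight_rot hE, map_hexSAWLaw_rot hE,
    map_carvedWeight_rot hE, map_carvedLaw_rot hE⟩

end Summit.CriticalPhenomena.SAWScalingLimit.Theorems.ObservableToSLE.TypeLadder

end
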